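import Mathlib
import Summits.QuantumAdvantage.QuantumAdvantage.Theorems.MobiusLadderQuadraticDigitPhasesStubCellForget
import Summits.QuantumAdvantage.QuantumAdvantage.Theorems.MobiusLadderQuadraticDigitPhasesStubOneCutKataiDigits

/-!
# Locality of the input-bit flip `T ↦ T ⊕ 2^b` under `T ↦ p·T` (stub `stub_flipGood`)

The stub `stub_flipGood` of the crux `MobiusLadder.QuadraticDigitPhases`
(stmt-QuantumAdvantage-1391), line `Sketch` (staged component of `stub_rankCore`), with its
lemmas.  Mathlib, plus two elementary arithmetic lemmas reused from the landed siblings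
`…StubCellForget` (`add_div_eq_of_mod_add_lt`) and `…StubOneCutKataiDigits` (`mul_block_eq`).

Fix an odd `p`, a position `b` and a window length `L`; write `T' := T ⊕ 2^b` and call `T`
*good* when the XOR pattern `pT ⊕ pT'` lies below `2^(b+L+1)`.  We prove:

1. the bits of `pT` below `b` are unchanged by the flip (`T' ≡ T (mod 2^b)`);
2. among the inputs `T < 2^N` (`b + L < N`) at most `(p+1)·2^(N-L-1)` are bad;
3. on a good `T` the carries `⌊p (T mod 2^i) / 2^i⌋` agree for `i ≤ b` and for `i > b + L`;
4. on a good `T` a second flip at a position `b' > b + L` does not change the pattern at `b`;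
5. a good pattern at an earlier position `b'` (`b' + L' < b`) is unchanged by the flip at `b`.

Everything rests on the blockwise behaviour of XOR, `(2^k a + x) ⊕ (2^k c + y) =
2^k (a ⊕ c) + (x ⊕ y)` for `x, y < 2^k` (`xor_blocks`), and its consequence
`x ⊕ y < 2^k ↔ ⌊x/2^k⌋ = ⌊y/2^k⌋` (`xor_lt_two_pow_iff`).

* (4), (5): write `T = 2^k H + S` (`S < 2^k`, `b < k`).  Then `T ⊕ 2^b = 2^k H + (S ⊕ 2^b)`,
  `T ⊕ 2^k = 2^k (H ⊕ 1) + S`, and `p (2^k A + S) = 2^k (pA + ⌊pS/2^k⌋) + (pS mod 2^k)`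
  (`mul_block_eq` of the sibling `…StubOneCutKataiDigits`).  Goodness
  below `2^k` forces the carries `⌊pS/2^k⌋ = ⌊p(S ⊕ 2^b)/2^k⌋` to agree, and then both patterns
  equal `(pS mod 2^k) ⊕ (p (S ⊕ 2^b) mod 2^k)`, independently of the high block (`pattern_stable`).
* (3): for `i > b + L`, `⌊p(T mod 2^i)/2^i⌋ = ⌊pT/2^i⌋ - p⌊T/2^i⌋`, and both terms agree for `T`
  and `T'` (goodness, resp. `b < i`); for `i ≤ b` already `T mod 2^i = T' mod 2^i`.
* (2): parametrise `T = 2^b (2^(L+1) hi + 2s + β) + lo` (`lo < 2^b`, `β < 2`, `s < 2^L`).  With the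
  carry `c := ⌊p·lo/2^b⌋`, badness means `⌊(2ps + c)/2^(L+1)⌋ ≠ ⌊(2ps + c + p)/2^(L+1)⌋` (for both
  values of `β`), which forces `(2ps + c) mod 2^(L+1) ≥ 2^(L+1) - p`, i.e.
  `(ps + ⌊c/2⌋) mod 2^L ≥ 2^L - (p+1)/2`.  As `p` is odd, `s ↦ (ps + ⌊c/2⌋) mod 2^L` is injective on
  `[0, 2^L)`, so at most `(p+1)/2` values of `s` are bad for each `(hi, β, lo)`; summing over the
  `2^(N-b-L-1) · 2 · 2^b` triples gives the bound `(p+1) 2^(N-L-1)`.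
-/

set_option linter.dupNamespace false -- D-0017: single-problem summit ⇒ `QuantumAdvantage.QuantumAdvantage` by design

namespace Summit.QuantumAdvantage.QuantumAdvantage.Theorems.MobiusLadderQuadraticDigitPhasesStubFlipGood

open Finset
open Summit.QuantumAdvantage.QuantumAdvantage.Theorems.MobiusLadderQuadraticDigitPhasesStubCellForget
  (add_div_eq_of_mod_add_lt)
open Summit.QuantumAdvantage.QuantumAdvantage.Theorems.MobiusLadderQuadraticDigitPhasesStubOneCutKatai
  (mul_block_eq)

/-! ## Blockwise XOR -/

/-- XOR acts blockwise on two-block numbers `2^k a + x` with `x < 2^k`. -/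
theorem xor_blocks (k a c x y : ℕ) (hx : x < 2 ^ k) (hy : y < 2 ^ k) :
    (2 ^ k * a + x) ^^^ (2 ^ k * c + y) = 2 ^ k * (a ^^^ c) + (x ^^^ y) := by
  apply Nat.eq_of_testBit_eq
  intro i
  rw [Nat.testBit_xor, Nat.testBit_two_pow_mul_add a hx, Nat.testBit_two_pow_mul_add c hy,
    Nat.testBit_two_pow_mul_add (a ^^^ c) (Nat.xor_lt_two_pow hx hy), Nat.testBit_xor,
    Nat.testBit_xor]
  by_cases h : i < k <;> simp [h]

/-- Two numbers agree above bit `k` iff their XOR is below `2^k`. -/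
theorem xor_lt_two_pow_iff (x y k : ℕ) : x ^^^ y < 2 ^ k ↔ x / 2 ^ k = y / 2 ^ k := by
  constructor
  · intro h
    have h0 : (x ^^^ y) / 2 ^ k = 0 := Nat.div_eq_of_lt h
    rw [Nat.xor_div_two_pow] at h0
    exact Nat.eq_of_xor_eq_zero h0
  · intro h
    have hpos : 0 < 2 ^ k := Nat.two_pow_pos k
    obtain ⟨r, hr, hxr⟩ : ∃ r, r < 2 ^ k ∧ x = 2 ^ k * (x / 2 ^ k) + r :=
      ⟨x % 2 ^ k, Nat.mod_lt _ hpos, (Nat.div_add_mod _ _).symm⟩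
    obtain ⟨r', hr', hyr⟩ : ∃ r', r' < 2 ^ k ∧ y = 2 ^ k * (y / 2 ^ k) + r' :=
      ⟨y % 2 ^ k, Nat.mod_lt _ hpos, (Nat.div_add_mod _ _).symm⟩
    rw [hxr, hyr, ← h, xor_blocks k _ _ _ _ hr hr', Nat.xor_self, mul_zero, zero_add]
    exact Nat.xor_lt_two_pow hr hr'

/-- Flipping bit `b` does not change the residue modulo `2^i` for `i ≤ b`. -/
theorem xor_two_pow_mod_of_le (T : ℕ) {b i : ℕ} (h : i ≤ b) :
    (T ^^^ 2 ^ b) % 2 ^ i = T % 2 ^ i := by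
  rw [Nat.xor_mod_two_pow, Nat.mod_eq_zero_of_dvd (Nat.pow_dvd_pow 2 h), Nat.xor_zero]

/-- Flipping bit `b` does not change the quotient by `2^i` for `b < i`. -/
theorem xor_two_pow_div_of_lt (T : ℕ) {b i : ℕ} (h : b < i) :
    (T ^^^ 2 ^ b) / 2 ^ i = T / 2 ^ i := by
  rw [Nat.xor_div_two_pow, Nat.div_eq_of_lt (Nat.pow_lt_pow_right (by norm_num) h), Nat.xor_zero]

/-- Flipping bit `b` of `2^b M + lo` with `M` even and `lo < 2^b` adds `2^b`. -/
theorem flip_even (b M lo : ℕ) (hM : Even M) (hlo : lo < 2 ^ b) :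
    (2 ^ b * M + lo) ^^^ 2 ^ b = 2 ^ b * (M + 1) + lo := by
  have h := xor_blocks b M 1 lo 0 hlo (Nat.two_pow_pos b)
  rwa [mul_one, add_zero, Nat.xor_zero, Nat.xor_one_of_even hM] at h

/-- Flipping bit `b` of `2^b (M + 1) + lo` with `M` even and `lo < 2^b` subtracts `2^b`. -/
theorem flip_odd (b M lo : ℕ) (hM : Even M) (hlo : lo < 2 ^ b) :
    (2 ^ b * (M + 1) + lo) ^^^ 2 ^ b = 2 ^ b * M + lo := by
  rw [← flip_even b M lo hM hlo, Nat.xor_xor_cancel_right]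

/-! ## Multiplying a two-block number -/

/-- Quotient of `p (2^k A + S)` by `2^k`: `pA` plus the carry `⌊pS/2^k⌋`. -/
theorem mul_blocks_div (p k A S : ℕ) : p * (2 ^ k * A + S) / 2 ^ k = p * A + p * S / 2 ^ k := by
  have : p * (2 ^ k * A + S) = 2 ^ k * (p * A) + p * S := by ring
  rw [this, Nat.mul_add_div (Nat.two_pow_pos k)]

/-- Quotient of `p (2^k A + S) + c` by `2^k`. -/
theorem mul_blocks_add_div (p k A S c : ℕ) :
    (p * (2 ^ k * A + S) + c) / 2 ^ k = p * A + (p * S + c) / 2 ^ k := by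
  have : p * (2 ^ k * A + S) + c = 2 ^ k * (p * A) + (p * S + c) := by ring
  rw [this, Nat.mul_add_div (Nat.two_pow_pos k)]

/-! ## Claims (1), (3), (4), (5) -/

/-- Claim (1): the bits of `pT` below `b` are unchanged by the flip of input bit `b`. -/
theorem testBit_mul_flip_low (p T b i : ℕ) (hi : i < b) :
    Nat.testBit (p * T) i = Nat.testBit (p * (T ^^^ 2 ^ b)) i := by
  have h1 : p * T % 2 ^ b = p * (T ^^^ 2 ^ b) % 2 ^ b := by
    rw [Nat.mul_mod, Nat.mul_mod p (T ^^^ 2 ^ b), xor_two_pow_mod_of_le T (le_refl b)]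
  have h2 : ∀ x, Nat.testBit x i = Nat.testBit (x % 2 ^ b) i := fun x => by
    rw [Nat.testBit_mod_two_pow]
    simp [hi]
  rw [h2 (p * T), h2 (p * (T ^^^ 2 ^ b)), h1]

/-- Claim (3), low part: for `i ≤ b` the carries `⌊p (T mod 2^i)/2^i⌋` of `T` and `T ⊕ 2^b`
agree. -/
theorem carry_eq_of_le (p T b i : ℕ) (h : i ≤ b) :
    p * (T % 2 ^ i) / 2 ^ i = p * ((T ^^^ 2 ^ b) % 2 ^ i) / 2 ^ i := by
  rw [xor_two_pow_mod_of_le T h]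

/-- Claim (3), high part: if `pT` and `p(T ⊕ 2^b)` agree above bit `k`, then for `i ≥ k`, `i > b`
the carries `⌊p (T mod 2^i)/2^i⌋` agree. -/
theorem carry_eq_of_good (p T b i k : ℕ) (hk : k ≤ i) (hb : b < i)
    (hgood : (p * T) ^^^ (p * (T ^^^ 2 ^ b)) < 2 ^ k) :
    p * (T % 2 ^ i) / 2 ^ i = p * ((T ^^^ 2 ^ b) % 2 ^ i) / 2 ^ i := by
  have key : ∀ x, p * x / 2 ^ i = p * (x / 2 ^ i) + p * (x % 2 ^ i) / 2 ^ i := fun x => by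
    conv_lhs => rw [← Nat.div_add_mod x (2 ^ i)]
    exact mul_blocks_div p i _ _
  have hq : p * T / 2 ^ i = p * (T ^^^ 2 ^ b) / 2 ^ i :=
    (xor_lt_two_pow_iff _ _ _).mp (lt_of_lt_of_le hgood (Nat.pow_le_pow_right (by norm_num) hk))
  have e1 := key T
  have e2 := key (T ^^^ 2 ^ b)
  rw [xor_two_pow_div_of_lt T hb, ← hq, e1] at e2
  omega

/-- Claims (4)/(5): if the pattern `pT ⊕ p(T ⊕ 2^b)` lies below `2^k` (`b < k`), then it is
unchanged when `T` is replaced by `T ⊕ 2^k`. -/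
theorem pattern_stable (p T b k : ℕ) (hb : b < k)
    (hgood : (p * T) ^^^ (p * (T ^^^ 2 ^ b)) < 2 ^ k) :
    (p * T) ^^^ (p * (T ^^^ 2 ^ b)) = (p * (T ^^^ 2 ^ k)) ^^^ (p * ((T ^^^ 2 ^ k) ^^^ 2 ^ b)) := by
  have hpos : 0 < 2 ^ k := Nat.two_pow_pos k
  have h2b : 2 ^ b < 2 ^ k := Nat.pow_lt_pow_right (by norm_num) hb
  obtain ⟨H, S, hS, rfl⟩ : ∃ H S, S < 2 ^ k ∧ T = 2 ^ k * H + S :=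
    ⟨T / 2 ^ k, T % 2 ^ k, Nat.mod_lt _ hpos, (Nat.div_add_mod _ _).symm⟩
  have hS' : S ^^^ 2 ^ b < 2 ^ k := Nat.xor_lt_two_pow hS h2b
  have hT1 : (2 ^ k * H + S) ^^^ 2 ^ b = 2 ^ k * H + (S ^^^ 2 ^ b) := by
    have h := xor_blocks k H 0 S (2 ^ b) hS h2b
    rwa [mul_zero, zero_add, Nat.xor_zero] at h
  have hT2 : (2 ^ k * H + S) ^^^ 2 ^ k = 2 ^ k * (H ^^^ 1) + S := by
    have h := xor_blocks k H 1 S 0 hS hpos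
    rwa [mul_one, add_zero, Nat.xor_zero] at h
  have hT3 : (2 ^ k * (H ^^^ 1) + S) ^^^ 2 ^ b = 2 ^ k * (H ^^^ 1) + (S ^^^ 2 ^ b) := by
    have h := xor_blocks k (H ^^^ 1) 0 S (2 ^ b) hS h2b
    rwa [mul_zero, zero_add, Nat.xor_zero] at h
  have hc : p * S / 2 ^ k = p * (S ^^^ 2 ^ b) / 2 ^ k := by
    have h1 := (xor_lt_two_pow_iff _ _ _).mp hgood
    rw [hT1, mul_blocks_div, mul_blocks_div] at h1
    exact Nat.add_left_cancel h1
  have hm1 : p * S % 2 ^ k < 2 ^ k := Nat.mod_lt _ hpos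
  have hm2 : p * (S ^^^ 2 ^ b) % 2 ^ k < 2 ^ k := Nat.mod_lt _ hpos
  rw [hT1, hT2, hT3, mul_block_eq p k H S, mul_block_eq p k H (S ^^^ 2 ^ b),
    mul_block_eq p k (H ^^^ 1) S, mul_block_eq p k (H ^^^ 1) (S ^^^ 2 ^ b), hc,
    xor_blocks k _ _ _ _ hm1 hm2, xor_blocks k _ _ _ _ hm1 hm2, Nat.xor_self, Nat.xor_self]

/-! ## Claim (2): counting the bad inputs -/

/-- Residues modulo `2X`: `(2y + ε) mod 2X = 2 (y mod X) + ε` for `ε < 2`. -/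
theorem two_mul_add_mod (y ε X : ℕ) (hε : ε < 2) (hX : 0 < X) :
    (2 * y + ε) % (2 * X) = 2 * (y % X) + ε := by
  have h1 : 2 * y + ε = 2 * X * (y / X) + (2 * (y % X) + ε) := by
    have h := Nat.div_add_mod y X
    calc 2 * y + ε = 2 * (X * (y / X) + y % X) + ε := by rw [h]
      _ = 2 * X * (y / X) + (2 * (y % X) + ε) := by ring
  rw [h1, Nat.mul_add_mod, Nat.mod_eq_of_lt]
  have := Nat.mod_lt y hX
  omega

/-- Core count: for odd `p` and any carry `c`, at most `(p+1)/2` values `s < 2^L` have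
`⌊(2ps + c)/2^(L+1)⌋ ≠ ⌊(2ps + p + c)/2^(L+1)⌋`.  Indeed this forces
`(ps + ⌊c/2⌋) mod 2^L ≥ 2^L - (p+1)/2`, and `s ↦ (ps + ⌊c/2⌋) mod 2^L` is injective. -/
theorem count_core (p L c : ℕ) (hp : Odd p) :
    ((range (2 ^ L)).filter (fun s => (p * (2 * s) + c) / 2 ^ (L + 1) ≠
      (p * (2 * s + 1) + c) / 2 ^ (L + 1))).card ≤ (p + 1) / 2 := by
  have hXpos : 0 < 2 ^ L := Nat.two_pow_pos L
  have hX2 : 2 ^ (L + 1) = 2 * 2 ^ L := by ring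
  have hp2 : p % 2 = 1 := Nat.odd_iff.mp hp
  have hcop : Nat.Coprime (2 ^ L) p := ((Nat.coprime_two_right.mpr hp).pow_right L).symm
  calc ((range (2 ^ L)).filter (fun s => (p * (2 * s) + c) / 2 ^ (L + 1) ≠
        (p * (2 * s + 1) + c) / 2 ^ (L + 1))).card
      ≤ (Ico (2 ^ L - (p + 1) / 2) (2 ^ L)).card := by
        refine card_le_card_of_injOn (fun s => (p * s + c / 2) % 2 ^ L) (fun s hs => ?_) ?_
        · rw [mem_coe, mem_filter, mem_range] at hs
          obtain ⟨-, hbad⟩ := hs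
          simp only [mem_coe, mem_Ico]
          refine ⟨?_, Nat.mod_lt _ hXpos⟩
          by_contra hlt
          apply hbad
          have hdecomp : p * (2 * s) + c = 2 * (p * s + c / 2) + c % 2 := by
            conv_lhs => rw [← Nat.div_add_mod c 2]
            ring
          rw [show p * (2 * s + 1) + c = p * (2 * s) + c + p by ring, hdecomp, hX2]
          symm
          apply add_div_eq_of_mod_add_lt
          rw [two_mul_add_mod _ _ _ (Nat.mod_lt c two_pos) hXpos]
          omega
        · intro s hs s' hs' h
          rw [mem_coe, mem_filter, mem_range] at hs hs'
          simp only at h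
          exact (Nat.ModEq.cancel_left_of_coprime hcop
            (Nat.ModEq.add_right_cancel' (c / 2) h)).eq_of_lt_of_lt hs.1 hs'.1
    _ = 2 ^ L - (2 ^ L - (p + 1) / 2) := Nat.card_Ico _ _
    _ ≤ (p + 1) / 2 := by omega

/-- Badness of the parametrised input `T = 2^b (2^(L+1) hi + 2s + β) + lo` (`β < 2`, `lo < 2^b`)
forces the core condition `⌊(2ps + c)/2^(L+1)⌋ ≠ ⌊(2ps + p + c)/2^(L+1)⌋` with the carry
`c = ⌊p·lo/2^b⌋`. -/
theorem bad_imp (p b L hi β lo s : ℕ) (hβ : β < 2) (hlo : lo < 2 ^ b)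
    (hbad : ¬ ((p * (2 ^ b * (2 ^ (L + 1) * hi + (2 * s + β)) + lo)) ^^^
      (p * ((2 ^ b * (2 ^ (L + 1) * hi + (2 * s + β)) + lo) ^^^ 2 ^ b)) < 2 ^ (b + L + 1))) :
    (p * (2 * s) + p * lo / 2 ^ b) / 2 ^ (L + 1) ≠
      (p * (2 * s + 1) + p * lo / 2 ^ b) / 2 ^ (L + 1) := by
  intro heq
  apply hbad
  have hK : 2 ^ (b + L + 1) = 2 ^ b * 2 ^ (L + 1) := by ring
  have hev : Even (2 ^ (L + 1) * hi + 2 * s) := ⟨2 ^ L * hi + s, by ring⟩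
  rw [xor_lt_two_pow_iff, hK, ← Nat.div_div_eq_div_mul, ← Nat.div_div_eq_div_mul]
  interval_cases β
  · rw [add_zero, flip_even b _ lo hev hlo, mul_blocks_div, mul_blocks_div, add_assoc,
      mul_blocks_add_div, mul_blocks_add_div, heq]
  · rw [← add_assoc, flip_odd b _ lo hev hlo, mul_blocks_div, mul_blocks_div, add_assoc,
      mul_blocks_add_div, mul_blocks_add_div, heq]

/-- Fibre bound: for fixed `(hi, β, lo)` at most `(p+1)/2` values `s < 2^L` give a bad input
`T = 2^b (2^(L+1) hi + 2s + β) + lo`. -/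
theorem fiber_bound (p b L hi β lo : ℕ) (hp : Odd p) (hβ : β < 2) (hlo : lo < 2 ^ b) :
    ((range (2 ^ L)).filter (fun s => ¬ ((p * (2 ^ b * (2 ^ (L + 1) * hi + (2 * s + β)) + lo)) ^^^
      (p * ((2 ^ b * (2 ^ (L + 1) * hi + (2 * s + β)) + lo) ^^^ 2 ^ b)) < 2 ^ (b + L + 1)))).card
      ≤ (p + 1) / 2 := by
  refine le_trans (card_le_card (fun s hs => ?_)) (count_core p L (p * lo / 2 ^ b) hp)
  rw [mem_filter] at hs ⊢
  exact ⟨hs.1, bad_imp p b L hi β lo s hβ hlo hs.2⟩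

/-- Claim (2): among the inputs `T < 2^N` (`b + L < N`) at most `(p+1) 2^(N-L-1)` are bad, i.e.
have a pattern `pT ⊕ p(T ⊕ 2^b)` reaching bit `b + L + 1` or higher. -/
theorem count_bad (p N L b : ℕ) (hp : Odd p) (hN : b + L < N) :
    ((Finset.range (2 ^ N)).filter
        (fun T => ¬ ((p * T) ^^^ (p * (T ^^^ 2 ^ b)) < 2 ^ (b + L + 1)))).card
      ≤ (p + 1) * 2 ^ (N - L - 1) := by
  obtain ⟨d, rfl⟩ : ∃ d, N = b + L + 1 + d := ⟨N - (b + L + 1), by omega⟩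
  obtain ⟨g, hg⟩ : ∃ g : (ℕ × ℕ × ℕ) × ℕ → ℕ,
      ∀ x, g x = 2 ^ b * (2 ^ (L + 1) * x.1.1 + (2 * x.2 + x.1.2.1)) + x.1.2.2 :=
    ⟨_, fun _ => rfl⟩
  have h2pos : 0 < 2 ^ b := Nat.two_pow_pos b
  have hYpos : 0 < 2 ^ (L + 1) := Nat.two_pow_pos _
  -- Step 1: every bad `T < 2^N` is `g` of a bad parameter quadruple.
  have h1 : ((range (2 ^ (b + L + 1 + d))).filter
        (fun T => ¬ ((p * T) ^^^ (p * (T ^^^ 2 ^ b)) < 2 ^ (b + L + 1)))).card ≤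
      ((((range (2 ^ d)) ×ˢ ((range 2) ×ˢ (range (2 ^ b)))) ×ˢ (range (2 ^ L))).filter
        (fun x => ¬ ((p * g x) ^^^ (p * (g x ^^^ 2 ^ b)) < 2 ^ (b + L + 1)))).card := by
    apply card_le_card_of_surjOn g
    intro T hT
    rw [mem_coe, mem_filter, mem_range] at hT
    obtain ⟨hT, hPT⟩ := hT
    have hdec : g ((T / 2 ^ b / 2 ^ (L + 1), (T / 2 ^ b % 2 ^ (L + 1) % 2, T % 2 ^ b)),
        T / 2 ^ b % 2 ^ (L + 1) / 2) = T := by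
      rw [hg]
      dsimp only
      rw [Nat.div_add_mod (T / 2 ^ b % 2 ^ (L + 1)) 2, Nat.div_add_mod (T / 2 ^ b) (2 ^ (L + 1)),
        Nat.div_add_mod T (2 ^ b)]
    refine ⟨_, ?_, hdec⟩
    rw [mem_coe, mem_filter, hdec]
    refine ⟨?_, hPT⟩
    simp only [mem_product, mem_range]
    refine ⟨⟨?_, Nat.mod_lt _ two_pos, Nat.mod_lt _ h2pos⟩, ?_⟩
    · rw [Nat.div_div_eq_div_mul, Nat.div_lt_iff_lt_mul (by positivity)]
      calc T < 2 ^ (b + L + 1 + d) := hT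
        _ = 2 ^ d * (2 ^ b * 2 ^ (L + 1)) := by ring
    · rw [Nat.div_lt_iff_lt_mul two_pos, ← pow_succ]
      exact Nat.mod_lt _ hYpos
  -- Step 2: fibrewise, at most `(p+1)/2` bad `s` for each `(hi, β, lo)`.
  have h2 : ((((range (2 ^ d)) ×ˢ ((range 2) ×ˢ (range (2 ^ b)))) ×ˢ (range (2 ^ L))).filter
        (fun x => ¬ ((p * g x) ^^^ (p * (g x ^^^ 2 ^ b)) < 2 ^ (b + L + 1)))).card ≤
      ((range (2 ^ d)) ×ˢ ((range 2) ×ˢ (range (2 ^ b)))).card * ((p + 1) / 2) := by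
    rw [card_filter, sum_product]
    refine (sum_le_card_nsmul _ _ ((p + 1) / 2) (fun a ha => ?_)).trans (le_of_eq (smul_eq_mul _ _))
    rcases a with ⟨hi, β, lo⟩
    simp only [mem_product, mem_range] at ha
    simp only [hg]
    rw [← card_filter]
    exact fiber_bound p b L hi β lo hp ha.2.1 ha.2.2
  have hA : ((range (2 ^ d)) ×ˢ ((range 2) ×ˢ (range (2 ^ b)))).card = 2 ^ d * (2 * 2 ^ b) := by
    simp only [card_product, card_range]
  obtain ⟨k, hk⟩ := hp
  calc ((range (2 ^ (b + L + 1 + d))).filter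
        (fun T => ¬ ((p * T) ^^^ (p * (T ^^^ 2 ^ b)) < 2 ^ (b + L + 1)))).card
      ≤ _ := h1
    _ ≤ _ := h2
    _ = (p + 1) * 2 ^ (b + L + 1 + d - L - 1) := by
      rw [hA, show b + L + 1 + d - L - 1 = b + d by omega, pow_add, hk,
        show (2 * k + 1 + 1) / 2 = k + 1 by omega]
      ring

/-! ## The stub -/

/-- **Stub `stub_flipGood`** (locality of the input-bit flip).  For odd `p` and `b + L < N`:
(1) the flip `T ↦ T ⊕ 2^b` never changes the bits of `pT` below `b`;
(2) the pattern `pT ⊕ p(T ⊕ 2^b)` is confined below bit `b + L + 1` ("good") for all but at most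
`(p+1) 2^(N-L-1)` inputs `T < 2^N`;
(3) on a good input the carries `⌊p (T mod 2^i)/2^i⌋` are unchanged for `i ≤ b` and `i > b + L`,
a later flip at `b' > b + L` does not change the pattern at `b`, and the flip at `b` does not
change any good pattern at an earlier position `b'` with `b' + L' < b`. -/
theorem stub_flipGood :
    ∀ (p N L b : ℕ), Odd p → b + L < N →
      (∀ T i : ℕ, i < b → Nat.testBit (p * T) i = Nat.testBit (p * (T ^^^ 2 ^ b)) i) ∧
      ((Finset.range (2 ^ N)).filter (fun T => ¬ ((p * T) ^^^ (p * (T ^^^ 2 ^ b)) < 2 ^ (b + L + 1)))).card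
          ≤ (p + 1) * 2 ^ (N - L - 1) ∧
      (∀ T : ℕ, (p * T) ^^^ (p * (T ^^^ 2 ^ b)) < 2 ^ (b + L + 1) →
        (∀ i, i ≤ b ∨ b + L < i → p * (T % 2 ^ i) / 2 ^ i = p * ((T ^^^ 2 ^ b) % 2 ^ i) / 2 ^ i) ∧
        (∀ b' : ℕ, b + L < b' →
          ((p * T) ^^^ (p * (T ^^^ 2 ^ b))) = ((p * (T ^^^ 2 ^ b')) ^^^ (p * ((T ^^^ 2 ^ b') ^^^ 2 ^ b)))) ∧
        (∀ b' L' : ℕ, b' + L' < b → (p * T) ^^^ (p * (T ^^^ 2 ^ b')) < 2 ^ (b' + L' + 1) →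
          ((p * T) ^^^ (p * (T ^^^ 2 ^ b'))) = ((p * (T ^^^ 2 ^ b)) ^^^ (p * ((T ^^^ 2 ^ b) ^^^ 2 ^ b'))))) := by
  intro p N L b hp hN
  refine ⟨fun T i hi => testBit_mul_flip_low p T b i hi, count_bad p N L b hp hN,
    fun T hgood => ⟨?_, ?_, ?_⟩⟩
  · intro i hi
    rcases hi with hi | hi
    · exact carry_eq_of_le p T b i hi
    · exact carry_eq_of_good p T b i (b + L + 1) (by omega) (by omega) hgood
  · intro b' hb'
    exact pattern_stable p T b b' (by omega)
      (lt_of_lt_of_le hgood (Nat.pow_le_pow_right (by norm_num) (by omega)))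
  · intro b' L' hb' hgood'
    exact pattern_stable p T b' b (by omega)
      (lt_of_lt_of_le hgood' (Nat.pow_le_pow_right (by norm_num) (by omega)))

end Summit.QuantumAdvantage.QuantumAdvantage.Theorems.MobiusLadderQuadraticDigitPhasesStubFlipGood
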